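import Summits.PneNP.PneNP.Theorems.SymmetryBudgetWindowHamIffNPNotSubsetPPoly
import Summits.PneNP.PneNP.Theorems.SymmetryBudgetPolylogHam
import Literature.Computability.Complexity.SymmetricCircuitFanIn
import Literature.Computability.Complexity.HeldKarpSymmetricCircuit

/-!
# STRATEGY CENSUS, cycle d1 (wall-breaker) — typed companion
# crux stmt-PneNP-2143 `SymmetryBudget.WindowHam`, route `route-PneNP-SymmetryBudget`

Crux-strategist seat `planner-cstrat-stmt-PneNP-2143-d1-0`, 2026-08-16/17 (human GO after the census of
seat `…-2143-0` and the kernel fact `windowHam_iff_npNotSubsetPPoly`).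

The human's directive: weaken `WindowHam` to EXACTLY what `closes (h₁ : WindowHam) (h₂ : HamCompiles)`
consumes — a budget regime, a restricted circuit class, a promise/a.e. variant — and ask whether
`HamCompiles` can be strengthened to meet a weakening for which symmetric-circuit lower bounds are
provable.  This file types that question and proves, over LANDED modules only (no `sorry`, no new
axiom, no Cruxes import):

* §1  the CELL calculus: a cell is a budget `g` and a class `R`; its two sides `LB g R` (no poly-size
      `R`-circuit, `Bud(m,g m)`-symmetric, computing HAM, i.o.) and `HC g R` (Cook's `NP ⊆ P` gives
      such circuits within one polynomial at every `m`).  `closes_cell : LB g R → HC g R → PneNP` for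
      EVERY cell — this is all that the route's `closes` consumes: SOME cell — and the two DEGENERACY
      LAWS
        `hc_iff_pneNP_of_lb : LB g R → (HC g R ↔ PneNP)`                (LB proved ⇒ HC is the summit),
        `lb_sandwich_of_hc : HC g R → (NP ⊄ P/poly → LB g R) ∧ (LB g R → PneNP)`
                                                                          (HC proved ⇒ LB is sandwiched
                                                                           between summit and super-summit);
* §2  the cells whose status the TREE already decides, kernel-checked: (log² m, all): LB = the proved
      support item `PolylogHam` ⇒ HC `↔ PneNP`; (log m, all): HC = the proved sibling crux ⇒ LB = the
      crux `↔ NP ⊄ P/poly`; (log m, fan-in `≤ ⌊log₂ m⌋/2`) and (log m, fan-in `2`): LB is a theorem of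
      the tree at ANY size ⇒ HC `↔ PneNP`; (0, all): LB `↔ NP ⊄ P/poly`; (log m, orbits `≤ m²·polylog`):
      the class contains an exact HAM circuit, so no any-size LB exists there (Held–Karp);
* §3  EXACTLY what the landed proof of `HamCompiles` consumes: hardness of the DECODER for the fixed
      Kotzig/cut-span interface `iface` of line `kotzig-cutspan` — `DecoderHardKC` — with the PROVED
      fixed-architecture compile `decodersKC_of_np_subset_PPoly`, `closesKC : DecoderHardKC → PneNP`,
      and the calibration `decoderHardKC_iff_npNotSubsetPPoly : DecoderHardKC ↔ NP ⊄ P/poly`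
      (the weakest consumed hypothesis is still Karp–Lipton's negated hypothesis: the feature layer is
      unconditional and the interface language is in NP);
* §4  signatures (elaborating, unproved here) of the remaining cells walked in `STRATEGY-CENSUS.md`,
      section "Cycle d1": bounded supports, formulas, bounded depth, monotone threshold, orbit bound,
      almost-everywhere and fixed-exponent sides, and the fixed-exponent compile hypothesis.

Companion prose: `Cruxes/WindowHam/STRATEGY-CENSUS.md`, section "Cycle d1 (wall-breaker)".
-/

set_option linter.dupNamespace false
set_option linter.unusedVariables false

namespace Summit.PneNP.PneNP.Cruxes.WindowHam.StrategistD1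

open Literature.Computability.Complexity Filter
open Summit.PneNP.PneNP (NPNotSubsetPPoly)
open Summit.PneNP.PneNP.Theses.SymmetryBudget (WindowHam HamCompiles PolylogHam)
open Summit.PneNP.PneNP.Theorems
open Summit.PneNP.PneNP.Theorems.WindowHam.Negative
open Summit.PneNP.PneNP.Theorems.HamCompiles.Negative (hamCompiles_iff)
open scoped Classical

/-! ## §1 The cell calculus: what `closes` consumes, and the two degeneracy laws -/

/-- A class of circuits: one predicate per input size `m`. -/
abbrev CClass : Type := ∀ m : ℕ, Circuit (Fin m × Fin m) → Prop

/-- The unrestricted class. -/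
def CAll : CClass := fun _ _ => True

/-- The restricted symmetric model of the cell `(g, R)` at size bound `s`: some threshold circuit of
class `R`, `Bud(m, g m)`-symmetric, with `≤ s` gates, computes `HAM_m`. -/
def InModel (g : ℕ → ℕ) (R : CClass) (m s : ℕ) : Prop :=
  ∃ C : Circuit (Fin m × Fin m), C.IsOver tcBasis ∧ C.size ≤ s ∧
    C.IsSymmetricUnder (pointStabiliserBudget m (g m)) ∧ R m C ∧ C.Computes (HamMatrix.hamFn m)

/-- Lower-bound side of the cell: for every polynomial, infinitely often no model circuit. -/
def LB (g : ℕ → ℕ) (R : CClass) : Prop :=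
  ∀ p : Polynomial ℕ, ∃ᶠ m in atTop, ¬ InModel g R m (p.eval m)

/-- Compile side of the cell: Cook's `NP ⊆ P` over `{0,1}` yields model circuits within one
polynomial at every `m` (the shape of the route's `HamCompiles`). -/
def HC (g : ℕ → ℕ) (R : CClass) : Prop :=
  PNPWave0.NP Bool ⊆ PNPWave0.P Bool → ∃ p : Polynomial ℕ, ∀ m : ℕ, InModel g R m (p.eval m)

/-- **What `closes` consumes is SOME cell**: for every budget `g` and every class `R`, the pair
`(LB g R, HC g R)` decides the summit by the route's five lines of logic. -/
theorem closes_cell (g : ℕ → ℕ) (R : CClass) (hW : LB g R) (hC : HC g R) : PneNP := by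
  by_contra hne
  have hsub : PNPWave0.NP Bool ⊆ PNPWave0.P Bool :=
    fun L hL => by_contra fun hL' => hne ⟨L, hL, hL'⟩
  obtain ⟨p, hp⟩ := hC hsub
  obtain ⟨m, hm⟩ := (hW p).exists
  exact hm (hp m)

/-- The compile side of every cell follows from the summit (its hypothesis is then absurd). -/
theorem hc_of_pneNP (g : ℕ → ℕ) (R : CClass) (h : PneNP) : HC g R := by
  intro hsub
  obtain ⟨L, hL, hL'⟩ := h
  exact absurd (hsub hL) hL'

/-- **DEGENERACY LAW 1.** As soon as the lower-bound side of a cell is a theorem, its compile side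
IS the summit — an implication from an absurd hypothesis, with no compilation content left. -/
theorem hc_iff_pneNP_of_lb (g : ℕ → ℕ) (R : CClass) (hW : LB g R) : HC g R ↔ PneNP :=
  ⟨closes_cell g R hW, hc_of_pneNP g R⟩

/-- Model circuits of a smaller class / smaller budget / smaller size are model circuits. -/
theorem InModel.mono {g g' : ℕ → ℕ} {R R' : CClass} {m s s' : ℕ} (hg : g' m ≤ g m)
    (hR : ∀ C, R m C → R' m C) (hs : s ≤ s') (h : InModel g R m s) : InModel g' R' m s' := by
  obtain ⟨C, hB, hsz, hS, hRC, hC⟩ := h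
  exact ⟨C, hB, hsz.trans hs, hS.mono (pointStabiliserBudget_mono m hg), hR C hRC, hC⟩

/-- `LB` is antitone in the class and in the budget (fewer circuits to exclude). -/
theorem LB.mono {g g' : ℕ → ℕ} {R R' : CClass} (hg : ∀ m, g m ≤ g' m)
    (hR : ∀ m C, R' m C → R m C) (h : LB g R) : LB g' R' :=
  fun p => (h p).mono fun m hm hm' => hm (hm'.mono (hg m) (hR m) le_rfl)

/-- `HC` is monotone in the class and in the budget. -/
theorem HC.mono {g g' : ℕ → ℕ} {R R' : CClass} (hg : ∀ m, g' m ≤ g m)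
    (hR : ∀ m C, R m C → R' m C) (h : HC g R) : HC g' R' :=
  fun hsub => by
    obtain ⟨p, hp⟩ := h hsub
    exact ⟨p, fun m => (hp m).mono (hg m) (hR m) le_rfl⟩

/-- Patching (the tree's `hasSym_ham_eventually_iff_forall` at budget `0`): general threshold
circuits for HAM within one polynomial from some `m` on give `HamMatrix.PolySize tcBasis`. -/
theorem polySize_of_eventually_general {p : Polynomial ℕ} {N : ℕ}
    (h : ∀ m ≥ N, ∃ C : Circuit (Fin m × Fin m),
      C.IsOver tcBasis ∧ C.size ≤ p.eval m ∧ C.Computes (HamMatrix.hamFn m)) :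
    HamMatrix.PolySize tcBasis := by
  have hev : ∃ p : Polynomial ℕ, ∃ N : ℕ, ∀ m ≥ N,
      HasSymCircuit tcBasis (pointStabiliserBudget m 0) (p.eval m) (HamMatrix.hamFn m) :=
    ⟨p, N, fun m hm => hasSymCircuit_budget_zero_iff.2 (h m hm)⟩
  obtain ⟨q, hq⟩ := (hasSym_ham_eventually_iff_forall (fun _ => 0)).1 hev
  exact ⟨q, fun m => hasSymCircuit_budget_zero_iff.1 (hq m)⟩

/-- **Karp–Lipton's negated hypothesis implies the lower-bound side of EVERY cell** (symmetric ⊆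
general; a class only removes circuits; patch small `m`; the landed HAM-matrix bridge). -/
theorem lb_of_npNotSubsetPPoly (g : ℕ → ℕ) (R : CClass) (h : NPNotSubsetPPoly) : LB g R := by
  intro p
  by_contra hfreq
  have hev : ∀ᶠ m in atTop, InModel g R m (p.eval m) := by
    simpa [Filter.not_frequently] using hfreq
  obtain ⟨N, hN⟩ := Filter.eventually_atTop.1 hev
  apply h
  rw [HamMatrix.np_subset_PPoly_iff_polySize_tcBasis]
  exact polySize_of_eventually_general (p := p) (N := N) fun m hm => by
    obtain ⟨C, hB, hs, -, -, hC⟩ := hN m hm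
    exact ⟨C, hB, hs, hC⟩

/-- **DEGENERACY LAW 2.** As soon as the compile side of a cell is a theorem, its lower-bound side
is sandwiched between the summit and `NP ⊄ P/poly`: it can never be "easier than the summit". -/
theorem lb_sandwich_of_hc (g : ℕ → ℕ) (R : CClass) (hC : HC g R) :
    (NPNotSubsetPPoly → LB g R) ∧ (LB g R → PneNP) :=
  ⟨lb_of_npNotSubsetPPoly g R, fun hW => closes_cell g R hW hC⟩

/-! ## §2 Cells the tree already decides -/

/-- The unrestricted model is `HasSymCircuit` verbatim. -/
theorem inModel_all_iff {g : ℕ → ℕ} {m s : ℕ} :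
    InModel g CAll m s ↔
      HasSymCircuit tcBasis (pointStabiliserBudget m (g m)) s (HamMatrix.hamFn m) := by
  simp only [InModel, CAll, true_and, HasSymCircuit]

/-- Cell (log m, all): its lower-bound side is the crux verbatim … -/
theorem lb_log_all_iff_windowHam : LB (Nat.log 2) CAll ↔ WindowHam := by
  simp only [LB, inModel_all_iff]
  rfl

/-- … and its compile side is the sibling crux `HamCompiles` verbatim, PROVED in the tree. -/
theorem hc_log_all_iff_hamCompiles : HC (Nat.log 2) CAll ↔ HamCompiles := by
  rw [hamCompiles_iff]
  simp only [HC, inModel_all_iff]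
  rfl

theorem hc_log_all : HC (Nat.log 2) CAll := hc_log_all_iff_hamCompiles.2 HamCompiles_proof

/-- So (law 2, sharpened by the tree): the crux's own cell has LB `↔ NP ⊄ P/poly` exactly. -/
theorem lb_log_all_iff_npNotSubsetPPoly : LB (Nat.log 2) CAll ↔ NPNotSubsetPPoly :=
  lb_log_all_iff_windowHam.trans windowHam_iff_npNotSubsetPPoly

/-- Cell (0, all) — the budget-0 end of the dial — has the same lower-bound side. -/
theorem lb_zero_all_iff_npNotSubsetPPoly : LB (fun _ => 0) CAll ↔ NPNotSubsetPPoly :=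
  ⟨fun h => lb_log_all_iff_npNotSubsetPPoly.1 (h.mono (fun _ => Nat.zero_le _) fun _ _ _ => trivial),
   lb_of_npNotSubsetPPoly _ _⟩

/-- Cell (log² m, all): its lower-bound side is the support item `PolylogHam`, PROVED in the tree
(supports + counting width on the planted family) … -/
theorem lb_logsq_all_iff_polylogHam : LB (fun m => Nat.log 2 m ^ 2) CAll ↔ PolylogHam := by
  simp only [LB, inModel_all_iff]
  rfl

theorem lb_logsq_all : LB (fun m => Nat.log 2 m ^ 2) CAll :=
  lb_logsq_all_iff_polylogHam.2 polylogHam_proof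

/-- … hence (law 1) the compile side at budget `log² m` IS the summit: "strengthen `HamCompiles` to
the budget where symmetric lower bounds are provable" has no compilation content. -/
theorem hc_logsq_all_iff_pneNP : HC (fun m => Nat.log 2 m ^ 2) CAll ↔ PneNP :=
  hc_iff_pneNP_of_lb _ _ lb_logsq_all

/-- Every cell with budget `≥ log² m` pointwise, whatever its class, inherits the theorem and with
it the degenerate compile side. -/
theorem hc_iff_pneNP_of_logsq_le {g : ℕ → ℕ} (hg : ∀ m, Nat.log 2 m ^ 2 ≤ g m) (R : CClass) :
    HC g R ↔ PneNP :=
  hc_iff_pneNP_of_lb g R (lb_logsq_all.mono hg fun _ _ _ => trivial)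

/-- The fan-in class: every gate reads at most `k m` wires. -/
def CFanIn (k : ℕ → ℕ) : CClass := fun m C => ∀ gt ∈ C.gates, gt.arity ≤ k m

/-- Cell (log m, fan-in `≤ ⌊log₂ m⌋ / 2`): its lower-bound side is a THEOREM of the tree at every
`m ≥ 8` and for circuits of ANY size (`Circuit.exists_gate_arity_gt_half_log_of_computes_ham`:
free `p`-cycles of the window vs rigid gates of fan-in `< p`) … -/
theorem lb_log_fanIn_half_log : LB (Nat.log 2) (CFanIn fun m => Nat.log 2 m / 2) := by
  intro p
  refine ((eventually_ge_atTop 8).mono fun m hm => ?_).frequently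
  rintro ⟨C, hB, -, hS, hR, hC⟩
  obtain ⟨gt, hgt, hlt⟩ := C.exists_gate_arity_gt_half_log_of_computes_ham hm hB hS hC
  exact absurd (hR gt hgt) (not_le.2 hlt)

/-- … hence its compile side ("`NP ⊆ P` ⇒ HAM has poly-size window circuits of fan-in
`≤ ⌊log₂ m⌋/2`") is the summit verbatim. -/
theorem hc_log_fanIn_half_log_iff_pneNP :
    HC (Nat.log 2) (CFanIn fun m => Nat.log 2 m / 2) ↔ PneNP :=
  hc_iff_pneNP_of_lb _ _ lb_log_fanIn_half_log

/-- Cell (log m, fan-in `2`) — the De Morgan / bounded-fan-in mutation — likewise. -/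
theorem lb_log_fanIn_two : LB (Nat.log 2) (CFanIn fun _ => 2) := by
  intro p
  refine ((eventually_ge_atTop 16).mono fun m hm => ?_).frequently
  rintro ⟨C, hB, -, hS, hR, hC⟩
  have hlog : 4 ≤ Nat.log 2 m := Nat.le_log_of_pow_le (by norm_num) hm
  obtain ⟨gt, hgt, hlt⟩ :=
    C.exists_gate_arity_gt_half_log_of_computes_ham (le_trans (by norm_num) hm) hB hS hC
  have h2 : gt.arity ≤ 2 := hR gt hgt
  omega

theorem hc_log_fanIn_two_iff_pneNP : HC (Nat.log 2) (CFanIn fun _ => 2) ↔ PneNP :=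
  hc_iff_pneNP_of_lb _ _ lb_log_fanIn_two

/-- The orbit class: every gate's orbit under the budget group has at most `s m` elements
(the hypothesis of every support theorem, Anderson–Dawar 2017 / Dawar–Wilsenach 2022–25 / Pago 2026). -/
def COrbit (s : ℕ → ℕ) : CClass := fun m C => C.orbitSize (pointStabiliserBudget m (Nat.log 2 m)) ≤ s m

/-- Cell (log m, orbits `≤ max(m(⌊log₂ m⌋+1)³, m²)`): unlike the fan-in cell, NO any-size lower
bound can hold — the class contains an exact window-symmetric HAM circuit (Held–Karp, landed). -/
theorem inModel_orbit_heldKarp {m : ℕ} (hm : 3 ≤ m) :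
    ∃ s : ℕ, InModel (Nat.log 2) (COrbit fun m => max (m * (Nat.log 2 m + 1) ^ 3) (m ^ 2)) m s := by
  obtain ⟨C, hB, hS, -, hC, hO⟩ := HeldKarp.exists_symmetric_circuit_log hm
  exact ⟨C.size, C, hB, le_rfl, hS, hO, hC⟩

/-! ## §3 EXACTLY what the landed proof of `HamCompiles` consumes: the decoder of line kotzig-cutspan -/

section KC

open Summit.PneNP.PneNP.Theorems.HamCompilesKC

/-- **Decoder hardness for the fixed Kotzig/cut-span interface.**  `iface m x : IIdx m → Bool` are
the `ell m ≤ 2m² + m⁵` Bud-invariant interface bits of the landed line (`stub_symmetricA`,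
`stub_symmetricF`: each has a poly-size window-symmetric threshold circuit), which decide
Hamiltonicity through the NP language `ResidueLang`.  The statement: for every polynomial,
infinitely often, NO general `B₂`-circuit with `≤ p m` gates decodes `HAM_m` from the interface. -/
def DecoderHardKC : Prop :=
  ∀ p : Polynomial ℕ, ∃ᶠ m in atTop, ¬ ∃ D : Circuit (Fin (ell m)),
    D.IsOver B2 ∧ D.size ≤ p.eval m ∧
      ∀ x : Fin m × Fin m → Bool, D.eval (fun j => iface m x ((iIdxEquiv m).symm j)) = hamFn m x

/-- **The fixed-architecture compile, PROVED** (the content of the landed line with the decoder made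
visible): `NP ⊆ P/poly` yields polynomial-size DECODERS for the interface at every `m ≥ 4`. -/
theorem decodersKC_of_np_subset_PPoly (h : Nondeterministic.NP ⊆ PPoly) :
    ∃ p : Polynomial ℕ, ∀ m, 4 ≤ m → ∃ D : Circuit (Fin (ell m)),
      D.IsOver B2 ∧ D.size ≤ p.eval m ∧
        ∀ x : Fin m × Fin m → Bool,
          D.eval (fun j => iface m x ((iIdxEquiv m).symm j)) = hamFn m x := by
  have hR : ResidueLang ∈ PPoly := h stub_residueNP
  obtain ⟨p₁, hp⟩ := Set.mem_iUnion.1 hR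
  obtain ⟨C, hC, hDec⟩ := hp
  refine ⟨p₁.comp ellPoly, fun m hm => ⟨C (ell m), (hC _).1, ?_, fun x => ?_⟩⟩
  · rw [Polynomial.eval_comp]
    exact (hC _).2.trans (eval_mono_nat p₁ (ell_le (by omega)))
  · have h2 : (C (ell m)).eval (fun j => iface m x ((iIdxEquiv m).symm j)) =
        ResidueLang.boolIndicator (encode m (iface m x)) := by
      rw [← eval_ofFn C]; exact hDec _
    rw [h2, Bool.eq_iff_iff, ← Set.mem_iff_boolIndicator, hamFn_eq_true_iff,
      isHamiltonian_iff_residue hm]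
    exact encode_mem_residueLang_iff hm (aData m x) (fData m x)

/-- The compile side with Cook's hypothesis (as in the route). -/
theorem decodersKC_of_npsubp (h : PNPWave0.NP Bool ⊆ PNPWave0.P Bool) :
    ∃ p : Polynomial ℕ, ∀ m, 4 ≤ m → ∃ D : Circuit (Fin (ell m)),
      D.IsOver B2 ∧ D.size ≤ p.eval m ∧
        ∀ x : Fin m × Fin m → Bool,
          D.eval (fun j => iface m x ((iIdxEquiv m).symm j)) = hamFn m x :=
  decodersKC_of_np_subset_PPoly (np_subset_ppoly_of_npsubp h)

/-- **`closes` through the decoder — the EXACT consumption.**  `DecoderHardKC` and the proved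
fixed-architecture compile decide the summit by the same five lines of logic. -/
theorem closesKC (h : DecoderHardKC) : PneNP := by
  by_contra hne
  have hsub : PNPWave0.NP Bool ⊆ PNPWave0.P Bool :=
    fun L hL => by_contra fun hL' => hne ⟨L, hL, hL'⟩
  obtain ⟨p, hp⟩ := decodersKC_of_npsubp hsub
  obtain ⟨m, hm, hm4⟩ := ((h p).and_eventually (eventually_ge_atTop 4)).exists
  exact hm (hp m hm4)

/-- `NP ⊆ P/poly` refutes decoder hardness (the interface language is in NP). -/
theorem not_decoderHardKC_of_np_subset_PPoly (h : Nondeterministic.NP ⊆ PPoly) : ¬ DecoderHardKC := by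
  obtain ⟨p, hp⟩ := decodersKC_of_np_subset_PPoly h
  intro hD
  obtain ⟨m, hm, hm4⟩ := ((hD p).and_eventually (eventually_ge_atTop 4)).exists
  exact hm (hp m hm4)

theorem npNotSubsetPPoly_of_decoderHardKC (h : DecoderHardKC) : NPNotSubsetPPoly :=
  fun hNP => not_decoderHardKC_of_np_subset_PPoly hNP h

/-- The composition step of the landed line, with an arbitrary decoder: symmetric feature circuits
plus a decoder give a window-symmetric HAM circuit (`hasSymCircuit_compose`, proved in the tree). -/
theorem hasSym_of_decoder {m : ℕ} (hm : 4 ≤ m) {q : Polynomial ℕ}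
    (hq : ∀ i : IIdx m, HasSymCircuit tcBasis (Bud m (gOf m)) (q.eval m) (fun x => iface m x i))
    {t : ℕ} (D : Circuit (Fin (ell m))) (hD : D.IsOver B2) (hDt : D.size ≤ t)
    (hDf : ∀ x : Fin m × Fin m → Bool,
      D.eval (fun j => iface m x ((iIdxEquiv m).symm j)) = hamFn m x) :
    HasSymCircuit tcBasis (Bud m (gOf m)) (ell m * q.eval m + 12 * t + 4) (hamFn m) := by
  choose Y hY using hq
  have hcomp := hasSymCircuit_compose (Bud m (gOf m))
    (fun j : Fin (ell m) => Y ((iIdxEquiv m).symm j))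
    (fun j => ⟨(hY _).1, (hY _).2.1, (hY _).2.2.1⟩) D hD hDt (ell_pos hm)
  have hfun : (fun x => D.eval fun j => (Y ((iIdxEquiv m).symm j)).eval x) = hamFn m := by
    funext x
    have h1 : (fun j => (Y ((iIdxEquiv m).symm j)).eval x) =
        fun j => iface m x ((iIdxEquiv m).symm j) := funext fun j => (hY _).2.2.2 x
    rw [h1, hDf x]
  rw [hfun] at hcomp
  exact hcomp

/-- Conversely, cheap decoders (eventually, one polynomial) refute the crux: bolt them onto the landed
symmetric interface circuits. So the crux implies decoder hardness — decoder hardness is the WEAKER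
statement, and it is exactly what `closes ∘ HamCompiles_proof` uses of `WindowHam`. -/
theorem not_windowHam_of_not_decoderHardKC (h : ¬ DecoderHardKC) : ¬ WindowHam := by
  simp only [DecoderHardKC, not_forall, Filter.not_frequently, not_not] at h
  obtain ⟨p, hp⟩ := h
  obtain ⟨N, hN⟩ := Filter.eventually_atTop.1 hp
  obtain ⟨qA, hqA⟩ := stub_symmetricA
  obtain ⟨qF, hqF⟩ := stub_symmetricF
  rw [not_windowHam_iff]
  refine ⟨ellPoly * (qA + qF) + Polynomial.C 12 * p + Polynomial.C 4, max N 4, fun m hm => ?_⟩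
  have hm4 : 4 ≤ m := le_of_max_le_right hm
  have hmN : N ≤ m := le_of_max_le_left hm
  obtain ⟨D, hD, hDt, hDf⟩ := hN m hmN
  have hq : ∀ i : IIdx m,
      HasSymCircuit tcBasis (Bud m (gOf m)) ((qA + qF).eval m) (fun x => iface m x i) := by
    rintro (i | i)
    · exact (hqA m hm4 i).mono (by rw [Polynomial.eval_add]; exact Nat.le_add_right _ _)
    · exact (hqF m hm4 i).mono (by rw [Polynomial.eval_add]; exact Nat.le_add_left _ _)
  have key := hasSym_of_decoder hm4 hq D hD hDt hDf
  have hev : (ellPoly * (qA + qF) + Polynomial.C 12 * p + Polynomial.C 4).eval m =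
      ellPoly.eval m * (qA + qF).eval m + 12 * p.eval m + 4 := by
    rw [Polynomial.eval_add, Polynomial.eval_add, Polynomial.eval_mul, Polynomial.eval_mul,
      Polynomial.eval_C, Polynomial.eval_C]
  rw [hev]
  refine key.mono ?_
  have h1 : ell m ≤ ellPoly.eval m := ell_le (by omega)
  have h3 : ell m * (qA + qF).eval m ≤ ellPoly.eval m * (qA + qF).eval m :=
    Nat.mul_le_mul_right _ h1
  omega

theorem decoderHardKC_of_windowHam (h : WindowHam) : DecoderHardKC := by
  by_contra hD
  exact not_windowHam_of_not_decoderHardKC hD h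

/-- **Calibration of the exact consumption: `DecoderHardKC ↔ NP ⊄ P/poly`** (kernel-checked over
landed modules).  The weakest hypothesis the existing deciding chain uses is still Karp–Lipton's
negated hypothesis — degeneracy law 2 made sharp for the architecture actually compiled. -/
theorem decoderHardKC_iff_npNotSubsetPPoly : DecoderHardKC ↔ NPNotSubsetPPoly :=
  ⟨npNotSubsetPPoly_of_decoderHardKC,
   fun h => decoderHardKC_of_windowHam (windowHam_of_npNotSubsetPPoly h)⟩

theorem decoderHardKC_iff_windowHam : DecoderHardKC ↔ WindowHam :=
  decoderHardKC_iff_npNotSubsetPPoly.trans windowHam_iff_npNotSubsetPPoly.symm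

end KC

/-! ## §4 The remaining cells of the map — signatures (elaborating; statuses in the prose census) -/

/-- Bounded supports: every gate is supported (tree's `Circuit.Supports`, the Anderson–Dawar /
Dawar–Wilsenach notion) by at most `k m` points of the window.  LB provable by the landed pipeline
for `k m < cw·⌊log₂ m⌋` (counting width of Hamiltonian path, linear); HC's conclusion is then
unconditionally false (law 1).  For `k m ≥ ⌊log₂ m⌋/2` the class is everything (law 2). -/
def CSupp (k : ℕ → ℕ) : CClass := fun m C =>
  ∀ j : Fin C.gates.length, ∃ S : Finset (Fin m), S.card ≤ k m ∧
    C.Supports (pointStabiliserBudget m (Nat.log 2 m)) (↑S : Set (Fin m)) j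

/-- Formulas (tree's `Circuit.IsFormula`: every gate is read at most once) — the He–Rossman /
Rossman size-sensitive symmetric technique lives here; in the window the free part has
inclusion–exclusion formulas of size `m^{1+o(1)}`, and the ordered block makes LB ≥ "HAM-path has no
poly-size threshold formulas" (frontier), HC unmotivated (`P = NP` gives no depth reduction). -/
def CFormula : CClass := fun _ C => C.IsFormula

/-- Bounded depth `d` (tree's `Circuit.depth`). Depth-2 threshold: Kane–Williams `n^{3/2}` gates is
the frontier; `NEXP ⊄ THR∘THR` open. -/
def CDepth (d : ℕ) : CClass := fun _ C => C.depth ≤ d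

/-- Monotone threshold circuits (no `¬` gate; `∧, ∨, MAJ` are monotone). LB on the Bud-fixed slice is a
monotone(-real) lower bound for HAM-path (not in print for HAM; Razborov/Alon–Boppana/Pudlák
techniques); HC's conclusion ("P = NP ⇒ poly-size MONOTONE circuits for HAM") has no support from
`P = NP` (Razborov 1985 / Tardos 1988: monotone ≠ general inside P). -/
def CMonotone : CClass := fun _ C => ∀ gt ∈ C.gates, gt.fn ≠ GateFn.not

/-- Almost-everywhere lower-bound side (a STRENGTHENING of `LB`; recorded because the human's list
mentions promise/a.e. variants: no a.e. argument is available that is not available i.o.). -/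
def LBae (g : ℕ → ℕ) (R : CClass) : Prop :=
  ∀ p : Polynomial ℕ, ∀ᶠ m in atTop, ¬ InModel g R m (p.eval m)

theorem lb_of_lbae {g : ℕ → ℕ} {R : CClass} (h : LBae g R) : LB g R :=
  fun p => (h p).frequently

/-- Fixed-exponent lower-bound side of a cell: size `≤ m ^ d`. `LB g R ↔ ∀ d, LBexp g R d` (easy
direction below).  Statuses at `(log m, all)`: `d = 0` elementary (heavy-gate averaging, census (i));
`d = 1` PROVABLE by communication complexity (Nisan 1993: a threshold gate costs `O(log n)` bits;
Hamiltonicity has randomized two-party complexity `Ω(m²)` on the Bachrach et al. 2019 family), NOT by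
supports (their reach is `d < H(1/4) ≈ 0.81`); `d = 2` beyond every known technique for unbounded-depth
threshold GATE counts (no explicit function is known to need `ω(n)` threshold gates); `d ≥ 3` ⇒ a
superlinear threshold-gate lower bound for an NP function; `∀ d` ⟺ `NP ⊄ P/poly`. -/
def LBexp (g : ℕ → ℕ) (R : CClass) (d : ℕ) : Prop :=
  ∃ᶠ m in atTop, ¬ InModel g R m (m ^ d)

theorem lbexp_of_lb {g : ℕ → ℕ} {R : CClass} (h : LB g R) (d : ℕ) : LBexp g R d := by
  have := h (Polynomial.X ^ d)
  simpa [LBexp, Polynomial.eval_pow, Polynomial.eval_X] using this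

/-- `L ∈ SIZE(p)`: one `B₂` circuit family of size `≤ p n` decides `L` (the summand of the tree's
`PPoly = ⋃ p, …`). -/
def InSIZE (L : Language Bool) (p : Polynomial ℕ) : Prop :=
  ∃ C : CircuitFamily, (∀ n, (C n).IsOver B2 ∧ (C n).size ≤ p.eval n) ∧ C.Decides L

/-- The fixed-exponent compile hypothesis matching `LBexp`: if the interface language of the landed
line has `B₂` circuits of size `n^k + k`, then HAM has window circuits of size `m^c` from some `m` on.
By `hasSym_of_decoder` this holds with `c = 5 + deg(q_A + q_F) ∨ 5k` up to constants — but `k` is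
not determined by `P = NP`, so no fixed-exponent pair closes the route (only `NP ⊄ SIZE(n^k)`-type
conclusions; census §D1-A4). -/
def HCexp (k c : ℕ) : Prop :=
  InSIZE Summit.PneNP.PneNP.Theorems.HamCompilesKC.ResidueLang (Polynomial.X ^ k + Polynomial.C k) →
    ∀ᶠ m in atTop, InModel (Nat.log 2) CAll m (m ^ c)

/-- The fixed-exponent cell closes only a fixed-exponent statement, never the summit: what the pair
`(LBexp, HCexp)` decides is the negation of the size hypothesis. -/
theorem not_inSIZE_of_lbexp_hcexp {k c : ℕ} (hW : LBexp (Nat.log 2) CAll c) (hC : HCexp k c) :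
    ¬ InSIZE Summit.PneNP.PneNP.Theorems.HamCompilesKC.ResidueLang
        (Polynomial.X ^ k + Polynomial.C k) := fun hS => by
  obtain ⟨m, hm, hm'⟩ := (hW.and_eventually (hC hS)).exists
  exact hm hm'

end Summit.PneNP.PneNP.Cruxes.WindowHam.StrategistD1
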